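import Literature.Computability.Complexity.SharpSATNormalForm
import Literature.Computability.Complexity.KSATReductions
import Literature.Computability.Complexity.CodeFPLists
import HarnessLib

/-!
# The normal form of Lemma 3 (Liśkiewicz–Ogihara–Toda 2003) is decidable in polynomial time

The counting problem `SHARP3SATNF` (`SharpSATNormalForm.lean`) is `#SAT` restricted to formulas in
the syntactic normal form of Lemma 3, `CNF.IsLOTNormalForm ψ` (one single-literal clause followed by
complementary pairs `D, D̄` of three-literal clauses): on other inputs it is `0`. Every reduction OUT
of `SHARP3SATNF` (Lemma 4: `#3SAT_NF ≤ᵖ_{r-shift} #HamPath`, tree fact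
`Literature.Barriers.CriticalPhenomena.GridSAW.LOT2003_lemma4_gadgets`) therefore has to TEST the
normal form in polynomial time and send the rejected inputs to a fixed instance of count `0`. This
file supplies that test, once and for all:

* `CNF.isComplPairs_iff_getElem` — `IsComplPairs rest` read position-wise: even length, the clauses
  at even positions have three literals, and each clause at an odd position is the literal-wise
  complement of its predecessor; `CNF.isLOTNormalForm_iff_head_tail`;
* `LOTNF.nfB ψ = decide (IsLOTNormalForm ψ)` (`LOTNF.nfB_eq`), a functional program over the clause
  list, and **`LOTNF.codeFP_nfB : CodeFP encodingCNF.encode bitE nfB`** (typed polynomial time on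
  codes, `CodeFP.lean`, by `mapIdx`/`all`/`rawGetD`);
* on strings: **`LOTNF.nfTestFn ∈ FP`** with `nfTestFn w = [decide (IsLOTNormalForm (decCNF w))]`
  (`LOTNF.nfTestFn_apply`), through the canonical re-encoding `KSATRed.canonCNFFn` of the total
  decoder `NegCNF.decCNF`.

## References

* M. Liśkiewicz, M. Ogihara, S. Toda, TCS 304 (2003) 129–156, §2.3, Lemma 3 (the normal form) and
  §3, Lemma 4 (its use).
* S. Arora, B. Barak, *Computational Complexity: A Modern Approach*, CUP 2009, §1.3 (closure of
  polynomial time under composition and bounded loops).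
-/

namespace Literature.Computability.Complexity

open _root_.Computability CodeFP

/-! ### The normal form, position-wise -/

namespace CNF

variable {ν : Type*}

/-- **Complementary pairs, position-wise**: even length, three literals at every even position, and
every clause at an odd position is the complement of its predecessor.
[cite: LiskiewiczOgiharaToda2003, Lemma 3 (1)] -/
theorem isComplPairs_iff_getElem : ∀ rest : CNF ν,
    IsComplPairs rest ↔ rest.length % 2 = 0 ∧ ∀ i (hi : i < rest.length),
      (i % 2 = 0 → (rest[i]).length = 3) ∧ (i % 2 = 1 → rest[i] = Clause.complement (rest[i - 1]'(by omega)))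
  | [] => by simp
  | [D] => by
    simp only [not_isComplPairs_singleton, List.length_cons, List.length_nil, zero_add, Nat.one_mod,
      one_ne_zero, false_and]
  | D :: D' :: rest => by
    rw [isComplPairs_cons_cons, isComplPairs_iff_getElem rest]
    simp only [List.length_cons]
    constructor
    · rintro ⟨hD, hD', hlen, h⟩
      refine ⟨by omega, fun i hi => ?_⟩
      match i with
      | 0 => exact ⟨fun _ => by simp [hD], fun h0 => by omega⟩
      | 1 => exact ⟨fun h1 => by omega, fun _ => by simp [hD']⟩
      | i + 2 =>
        obtain ⟨h1, h2⟩ := h i (by omega)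
        refine ⟨fun he => ?_, fun ho => ?_⟩
        · simpa using h1 (by omega)
        · obtain ⟨j, rfl⟩ : ∃ j, i = j + 1 := ⟨i - 1, by omega⟩
          have := h2 (by omega)
          simpa using this
    · rintro ⟨hlen, h⟩
      refine ⟨by simpa using (h 0 (by omega)).1 rfl, by simpa using (h 1 (by omega)).2 rfl, by omega, fun i hi => ?_⟩
      obtain ⟨h1, h2⟩ := h (i + 2) (by omega)
      refine ⟨fun he => by simpa using h1 (by omega), fun ho => ?_⟩
      obtain ⟨j, rfl⟩ : ∃ j, i = j + 1 := ⟨i - 1, by omega⟩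
      have := h2 (by omega)
      simpa using this

/-- **The normal form, read off head and tail**: a nonempty formula whose first clause has one
literal and whose other clauses form complementary pairs. [cite: LiskiewiczOgiharaToda2003, Lemma 3 (1)] -/
theorem isLOTNormalForm_iff_head_tail (ψ : CNF ν) :
    IsLOTNormalForm ψ ↔ ψ ≠ [] ∧ (ψ.headD []).length = 1 ∧ IsComplPairs ψ.tail := by
  match ψ with
  | [] => simp [IsLOTNormalForm]
  | [] :: rest => simp [IsLOTNormalForm]
  | [l] :: rest => simp
  | (a :: b :: c) :: rest => simp [IsLOTNormalForm]

end CNF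

/-! ### The test as a functional program, and on codes -/

namespace LOTNF

/-- The code of a CNF, `encodingCNF`, in the algebra of `CodeFP.lean`. [folklore] -/
def cnfE : CNF ℕ → List Bool := listE (listE (pairE natE bitE))

/-- The literal code. [folklore] -/
abbrev litE : ℕ × Bool → List Bool := pairE natE bitE

/-- `cnfE` is `encodingCNF.encode`. [folklore] -/
theorem cnfE_eq : (encodingCNF.encode : CNF ℕ → List Bool) = cnfE := by
  unfold cnfE encodingCNF encodingClause encodingLiteral
  rw [listE_eq, listE_eq, pairE_eq, natE_eq, bitE_eq]

/-- The position-wise test of one clause of the tail against the tail `rest`. [folklore] -/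
def pairTestB (rest : CNF ℕ) (i : ℕ) (D : Clause ℕ) : Bool :=
  if i % 2 = 0 then decide (D.length = 3) else decide (D = Clause.complement (rest.getD (i - 1) []))

/-- **The complementary-pairs test.** [folklore] -/
def icpB (rest : CNF ℕ) : Bool :=
  decide (rest.length % 2 = 0) && (rest.mapIdx (pairTestB rest)).all (fun b => b)

/-- **The normal-form test.** [folklore] -/
def nfB (ψ : CNF ℕ) : Bool :=
  !ψ.isEmpty && decide ((ψ.headD []).length = 1) && icpB ψ.tail

/-- `icpB` decides `IsComplPairs`. [folklore] -/
theorem icpB_eq (rest : CNF ℕ) : icpB rest = decide (CNF.IsComplPairs rest) := by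
  rw [Bool.eq_iff_iff]
  simp only [icpB, Bool.and_eq_true, decide_eq_true_eq, List.all_eq_true, CNF.isComplPairs_iff_getElem]
  constructor
  · rintro ⟨hlen, h⟩
    refine ⟨hlen, fun i hi => ?_⟩
    have hb := h (pairTestB rest i rest[i]) (by
      rw [List.mem_iff_getElem]
      exact ⟨i, by simpa using hi, by simp⟩)
    unfold pairTestB at hb
    constructor
    · intro he; rw [if_pos he] at hb; simpa using hb
    · intro ho
      rw [if_neg (by omega)] at hb
      have := of_decide_eq_true hb
      rw [this, List.getD_eq_getElem _ _ (by omega)]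
  · rintro ⟨hlen, h⟩
    refine ⟨hlen, fun b hb => ?_⟩
    rw [List.mem_iff_getElem] at hb
    obtain ⟨i, hi, rfl⟩ := hb
    rw [List.length_mapIdx] at hi
    simp only [List.getElem_mapIdx]
    unfold pairTestB
    split_ifs with he
    · exact decide_eq_true ((h i hi).1 he)
    · rw [List.getD_eq_getElem _ _ (by omega)]
      exact decide_eq_true ((h i hi).2 (by omega))

/-- **`nfB` decides the normal form.** [cite: LiskiewiczOgiharaToda2003, Lemma 3 (1)] -/
theorem nfB_eq (ψ : CNF ℕ) : nfB ψ = decide (CNF.IsLOTNormalForm ψ) := by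
  rw [Bool.eq_iff_iff]
  simp only [nfB, icpB_eq, Bool.and_eq_true, Bool.not_eq_true', decide_eq_true_eq, CNF.isLOTNormalForm_iff_head_tail,
    List.isEmpty_eq_false_iff, ne_eq]
  tauto

/-- The clauses as a raw list of raw clauses. [cite: AroraBarak2009, §1.3] -/
theorem rawClausesFP : CodeFP cnfE (rawE (rawE litE)) (fun ψ => ψ) :=
  ((map₀ (rawOfList litE)).comp (rawOfList (listE litE))).congr fun ψ => by simp

/-- The literal-wise complement of a raw clause. [cite: AroraBarak2009, §1.3] -/
theorem complementFP : CodeFP (rawE litE) (rawE litE) Clause.complement :=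
  (map₀ (g := Literal.negate) ((fst natE bitE).pair (snd natE bitE).not)).congr fun _ => rfl

/-- The position-wise pair test, with the tail as context. [cite: AroraBarak2009, §1.3] -/
theorem pairTestFP : CodeFP (pairE (rawE (rawE litE)) (pairE natE (rawE litE))) bitE
    (fun p => pairTestB p.1 p.2.1 p.2.2) := by
  have hi : CodeFP (pairE (rawE (rawE litE)) (pairE natE (rawE litE))) natE (fun p => p.2.1) := (snd _ _).fst'
  have hD : CodeFP (pairE (rawE (rawE litE)) (pairE natE (rawE litE))) (rawE litE) (fun p => p.2.2) := (snd _ _).snd'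
  have hrest : CodeFP (pairE (rawE (rawE litE)) (pairE natE (rawE litE))) (rawE (rawE litE)) (fun p => p.1) := fst _ _
  have heven : CodeFP (pairE (rawE (rawE litE)) (pairE natE (rawE litE))) bitE (fun p => decide (p.2.1 % 2 = 0)) :=
    (natEq.comp ((natMod.comp (hi.pair (const _ 2))).pair (const _ 0))).congr fun _ => rfl
  have hlen3 : CodeFP (pairE (rawE (rawE litE)) (pairE natE (rawE litE))) bitE (fun p => decide (p.2.2.length = 3)) :=
    (natEq.comp (((natLength litE).comp hD).pair (const _ 3))).congr fun _ => rfl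
  have hprev : CodeFP (pairE (rawE (rawE litE)) (pairE natE (rawE litE))) (rawE litE) (fun p => p.1.getD (p.2.1 - 1) []) :=
    ((rawGetD (rawE litE) (d := ([] : List (ℕ × Bool))) (by simp [rawE])).comp
      (hrest.pair (natSub.comp (hi.pair (const _ 1))))).congr fun _ => rfl
  have hcompl : CodeFP (pairE (rawE (rawE litE)) (pairE natE (rawE litE))) bitE
      (fun p => decide (p.2.2 = Clause.complement (p.1.getD (p.2.1 - 1) []))) :=
    ((eq (rawE_injective (pairE_injective natE_injective bitE_injective))).comp (hD.pair (complementFP.comp hprev))).congr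
      fun _ => rfl
  exact (heven.ite hlen3 hcompl).congr fun p => by unfold pairTestB; by_cases h : p.2.1 % 2 = 0 <;> simp [h]

/-- The complementary-pairs test on raw clause lists. [cite: AroraBarak2009, §1.3] -/
theorem icpFP : CodeFP (rawE (rawE litE)) bitE icpB := by
  have hlen : CodeFP (rawE (rawE litE)) bitE (fun rest => decide (rest.length % 2 = 0)) :=
    (natEq.comp ((natMod.comp ((natLength (rawE litE)).pair (const _ 2))).pair (const _ 0))).congr fun _ => rfl
  have hmap : CodeFP (rawE (rawE litE)) (rawE bitE) (fun rest => rest.mapIdx (pairTestB rest)) :=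
    ((mapIdx (σ := List (List (ℕ × Bool))) (g := fun p => pairTestB p.1 p.2.1 p.2.2) pairTestFP).comp
      ((CodeFP.id _).pair (CodeFP.id _))).congr fun _ => rfl
  have hall : CodeFP (rawE (rawE litE)) bitE (fun rest => (rest.mapIdx (pairTestB rest)).all (fun b => b)) :=
    ((all (σ := Unit) (eσ := unitE) (p := fun q => q.2) (snd unitE bitE)).comp ((const _ ()).pair hmap)).congr fun _ => rfl
  exact (hlen.and hall).congr fun _ => rfl

/-- **The normal-form test is typed polynomial time on codes.** [cite: LiskiewiczOgiharaToda2003, Lemma 3; AroraBarak2009, §1.3] -/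
theorem codeFP_nfB : CodeFP cnfE bitE nfB := by
  have hne : CodeFP cnfE bitE (fun ψ : CNF ℕ => !ψ.isEmpty) := ((rawIsEmpty (rawE litE)).comp rawClausesFP).not
  have hhead : CodeFP cnfE bitE (fun ψ : CNF ℕ => decide ((ψ.headD []).length = 1)) :=
    (natEq.comp ((((natLength litE).comp ((rawHeadD (rawE litE) (d := ([] : List (ℕ × Bool))) (by simp [rawE])).comp
      rawClausesFP))).pair (const _ 1))).congr fun _ => rfl
  have htail : CodeFP cnfE bitE (fun ψ : CNF ℕ => icpB ψ.tail) := icpFP.comp ((rawTail (rawE litE)).comp rawClausesFP)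
  exact ((hne.and hhead).and htail).congr fun _ => rfl

/-- The same over `encodingCNF.encode`, as a decision of the normal form. [cite: LiskiewiczOgiharaToda2003, Lemma 3] -/
theorem codeFP_isLOTNormalForm :
    CodeFP (encodingCNF.encode : CNF ℕ → List Bool) bitE (fun ψ => decide (CNF.IsLOTNormalForm ψ)) := by
  rw [cnfE_eq]
  exact codeFP_nfB.congr nfB_eq

/-! ### On strings: testing the decoded formula -/

/-- The canonical re-encoding reads the decoded formula. [cite: AroraBarak2009, §1.3] -/
theorem codeFP_decCNF : CodeFP strE (encodingCNF.encode : CNF ℕ → List Bool) NegCNF.decCNF :=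
  ⟨KSATRed.canonCNFFn, KSATRed.canonCNFFn_mem_FP, fun w => KSATRed.canonCNFFn_eq w⟩

/-- **The normal-form test on strings**: the one-bit answer for the decoded formula. [cite: LiskiewiczOgiharaToda2003, Lemma 3] -/
noncomputable def nfTestFn : List Bool → List Bool :=
  Classical.choose (codeFP_isLOTNormalForm.comp codeFP_decCNF)

/-- `nfTestFn ∈ FP`. [cite: AroraBarak2009, §1.3] -/
theorem nfTestFn_mem_FP : nfTestFn ∈ FP :=
  (Classical.choose_spec (codeFP_isLOTNormalForm.comp codeFP_decCNF)).1

/-- `nfTestFn w = [decide (IsLOTNormalForm (decCNF w))]`. [cite: LiskiewiczOgiharaToda2003, Lemma 3] -/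
theorem nfTestFn_apply (w : List Bool) : nfTestFn w = [decide (CNF.IsLOTNormalForm (NegCNF.decCNF w))] :=
  (Classical.choose_spec (codeFP_isLOTNormalForm.comp codeFP_decCNF)).2 w

/-- The test as a typed map on strings. [cite: LiskiewiczOgiharaToda2003, Lemma 3] -/
theorem codeFP_nfTest : CodeFP strE bitE (fun w => decide (CNF.IsLOTNormalForm (NegCNF.decCNF w))) :=
  codeFP_isLOTNormalForm.comp codeFP_decCNF

end LOTNF

end Literature.Computability.Complexity
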